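import Literature.NumberTheory.EllipticCurves.ManinConstantQuadraticTwist
import Literature.NumberTheory.EllipticCurves.Isogeny
import HarnessLib
import HarnessLib.Audit.Tags

/-!
# Candidates E-imc-17 / E-imc-18: TWIST RE-ROOTING — the `X₀`-optimal curve of a ramified quadratic-twist
# class is the FALTINGS-MINIMAL curve (`OptimalIsMinimalOfTwist p`), hence every Manin constant of the class is
# `±` a power of `2` when the partner class is semistable (`ManinTwoPowOfTwistOfSemistable p`) — cell
# `bsd-f2-manin` (D-0131 (3) frontier: the Manin constant at additive primes). `@[conjecture]` leaf (NOTHING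
# asserted; definitions only).

HONEST FRAMING. LENS = Iwasawa-main-conjecture / family-integrality read as TWIST RE-ROOTING (planner-of-record
`bsd-f2-manin-imc` g4, HOME `run/shared/lean/pub/bsd-f2-manin/MEMO-imc.md` §12; Props VERBATIM from
HOME/imc/Sketch-imc-g4.lean sha16 1179235f32fa830a, namespace `BsdF2ManinImcG4`, farm rc 0 · 0 sorries ·
0 warnings).  MECHANISM (now in the tree, PROVED: `Literature/NumberTheory/EllipticCurves/Gamma1PeriodLatticeGamma0TwistProofs.lean`):
LEMMA⁺ `GaussSumMulMemGamma1OfMemGamma0Twist` (`g(χ)·Λ(f ⊗ χ; Γ₀(L)) ⊆ Λ₁(f; Γ₁(N))`) and the squeeze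
`OptimalManinDvdGamma1Manin` (`c₀(𝒜′ ⊗ χ) ∣ c₁(A)` for every `X₁(N′)`-datum of every `A ∈ 𝒜′`): the
`X₀`-OPTIMAL curve `E₀(𝒜)` of the twisted class sits BELOW `E₁(𝒜′) ⊗ χ` in the lattice order, and Stevens'
conjecture `E₁(𝒜′) = E_*(𝒜′)` (Vatsal 2005 Thm 1.10: odd part, `𝒜′` semistable) squeezes it onto the minimal
curve: `E₀(𝒜) = E_*(𝒜)` (E-imc-17), whence every curve of `𝒜` has Manin constant a power of `2` (E-imc-18).
BC5 WITNESS: HOME/imc/g4-reroot2.py → g4-reroot2.out (Cremona ecdata `N < 5·10⁵`, TWISTCENSUS2 found-otherN rows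
with partner semistable at `p`; 935 907 twist edges): `E₀(𝒜) ⊗ ψ = E_*(𝒜′)` in 1 515 / 1 515 rows whose partner
class has a curve with `c > 1`, and `E₀(𝒜) ⊗ ψ = E₀(𝒜′) (= E_*(𝒜′))` in 934 390 / 934 392 rows with `c ≡ 1` on
the partner class; the 2 exceptions are the two twist edges of 390150gy, where the same lattice chain PROVES that
the optimality label is wrong (E-imc-19, leaf `Cremona390150gyNotOptimal`).  NOT IN PRINT (refuter-2 g4, R-imc-10,
ref2/LIT-PLACEMENT v5 §F⁵): no source locates `E₀` of a ramified-twist class (Edixhoven 1991 §4 three lattice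
positions nearest; Gross–… GJL25 = `E_*` side); E-imc-18 is a PRINT-COROLLARY CANDIDATE of Vatsal 2005 Thm 1.10
+ Stevens (5.2)/Thm 5.1 + `c₀ = c₁ = 1` semistable THROUGH the (now proved) LEMMA⁺/squeeze ⇒ beyond-print YES
(small).  Refuter verdicts: REF1 **SURVIVES ×2** (HOME/REFUTER-ref1.md §R13, 18:01Z: BC7 CLEAN; read-back:
lattice-optimal pins `W = E₀` and `D = ±φ₀`; the `cuspCoeff` identity ∀ n forces `W ∼ A ⊗ χ` with `¬ p² ∣ N′` =
«𝒜′ semistable at `p`»; `[W₂.IsGloballyMinimal]` load-bearing and present; `∀ D₃, D₂.deg ≤ D₃.deg` pins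
`D₂ = ±ψ_min ∘ φ₀`; 390150gy is OUTSIDE the habitat); REF2 as above.
-/

noncomputable section

open scoped MatrixGroups ModularForm

open CongruenceSubgroup WeierstrassCurve
  Literature.NumberTheory.EllipticCurves Literature.NumberTheory.EllipticCurves.ModularForms

namespace Summit.BirchSwinnertonDyer.Rank1Residual.ManinAdditive

/-- **Candidate E-imc-17 `OptimalIsMinimalOfTwist p` (cell bsd-f2-manin, MEMO-imc §12; the RE-ROOTING LAW —
NOT in print, nothing asserted; proof route: tree squeeze `OptimalManinDvdGamma1Manin` ∘ Stevens (5.2) ∘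
[Stevens' conjecture `E₁(𝒜′) = E_*(𝒜′)`, Vatsal 2005 Thm 1.10 for the odd part when `𝒜′` is semistable]).**
If the class of the globally minimal `W` is the `χ`-twist (`χ` primitive quadratic mod the odd prime `p`) of the
class of `A`, with `A` semistable at `p` (`p² ∤ N′`), `N′ ∣ N`, `p² ∣ N`, `N′ p ∣ N` (`N = N(W)`, `N′ = N(A)`),
`aₙ(f_D) = χ(n)·aₙ(f_{D′})` for the data `D` (LATTICE-OPTIMAL `X₀(N)`-datum of `W`: `W` is the optimal curve)
and `D′` (any `X₀(N′)`-datum of `A`), then `W` is the MINIMAL curve of its class: `Λ_W ⊆ Λ_{W₂}` for every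
globally minimal `W₂` isogenous to `W` (`_φ`, decorative) and every Néron pair `L₂` of `W₂` (Stevens 1989
Thm 2.3 ⟺ minimal Faltings height ⟺ étale isogenies `W → W₂`).  BC5: 1 515 / 1 515 flips + 934 390 / 934 392
commuting twist edges (the 2 = 390150gy, refuted as data by E-imc-19); odd `p` alone: 1 327 / 1 327 +
737 775 / 737 777.  Why it might fail: a class `𝒜′` where Stevens' conjecture fails 2-adically (`E_* → E₁` of
degree `2^k`, allowed by Vatsal 1.10) with `E₀(𝒜)` strictly between `E_*(𝒜)` and `E₁(𝒜′) ⊗ χ`; none below `5·10⁵`.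
[cite: Vatsal2005, Conj. 1.9 and Thms 1.10–1.11 (shape only: Stevens' E₁ = E_* for semistable classes, odd part; the location of E₀ of a RAMIFIED-TWIST class is NOT in print — cell bsd-f2-manin MEMO-imc.md §12, E-imc-17)]
[cite: Stevens1989, Thm. 2.3 and §5] -/
@[conjecture] def OptimalIsMinimalOfTwist (p : ℕ) : Prop :=
  ∀ (A W : WeierstrassCurve ℚ) [A.IsElliptic] [A.IsGloballyMinimal] [W.IsElliptic]
    [W.IsGloballyMinimal] [NeZero (W.conductorNorm ℤ)] [NeZero (A.conductorNorm ℤ)] [NeZero p]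
    (χ : DirichletCharacter ℂ p) (D' : ModularParametrizationData A (A.conductorNorm ℤ))
    (D : ModularParametrizationData W (W.conductorNorm ℤ)),
    p.Prime → p ≠ 2 → χ.IsQuadratic → χ.IsPrimitive →
    (∀ z ∈ D.L.lattice, ∃ w ∈ periodLattice D.f, z = D.c * w) →
    A.conductorNorm ℤ ∣ W.conductorNorm ℤ → p ^ 2 ∣ W.conductorNorm ℤ →
    A.conductorNorm ℤ * p ∣ W.conductorNorm ℤ → ¬ (p ^ 2 ∣ A.conductorNorm ℤ) →
    (∀ n : ℕ, cuspCoeff D.f n = χ n * cuspCoeff D'.f n) →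
    ∀ (W₂ : WeierstrassCurve ℚ) [W₂.IsElliptic] [W₂.IsGloballyMinimal]
      (_φ : WeierstrassCurve.Isogeny W W₂) (L₂ : PeriodPair),
      IsNeronLatticeOf (W₂.baseChange ℂ) L₂ → ∀ z ∈ D.L.lattice, z ∈ L₂.lattice

/-- **Candidate E-imc-18 `ManinTwoPowOfTwistOfSemistable p` (cell bsd-f2-manin, MEMO-imc §12.4; THEOREM
CANDIDATE — paper proof from the tree squeeze `OptimalManinDvdGamma1Manin` + Stevens (5.2) [tree] + Česnavičius
2018 (`q² ∤ N′ ⇒ q ∤ c₁`) [tree fact] + Vatsal 2005 Thm 1.10 [to be filed statement-only] + the Néron mapping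
property [tree]; nothing asserted here).**  In the situation of E-imc-17 with `𝒜′` SEMISTABLE (`N(A)` squarefree):
for every globally minimal `W₂` isogenous to the optimal `W` (`_φ`, decorative) and every `X₀(N)`-datum `D₂` of
`W₂` of minimal degree, the Manin constant `c(D₂)` is `±` a power of `2` (conjecturally `±1`).  Contrast:
untwisted semistable classes have `c ∈ {3, 5}` 38 times below `5·10⁵` (11a3, 14a4, 19a3, …); their ramified odd
twists never do.  BC5: as E-imc-17 (935 907 twist edges, 0 violations after the E-imc-19 correction).  Why it
might fail: the 2-power is forced by Vatsal's «ℓ odd» restriction; the statement itself fails only if the paper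
chain does, or in Lean through the analytic/algebraic datum mismatch of `ModularParametrizationData`.
[cite: Vatsal2005, Thm. 1.10 (verbatim p. 7: semistable optimal quotients, ℓ odd; PRINT-COROLLARY CANDIDATE through the tree squeeze — the twisted-class 2-power statement is NOT in print; cell bsd-f2-manin MEMO-imc.md §12.4, E-imc-18)]
[cite: Cesnavicius2018, Thm. 1.2] [cite: Stevens1989, Lemma (5.2) and Thm. 2.3] -/
@[conjecture] def ManinTwoPowOfTwistOfSemistable (p : ℕ) : Prop :=
  ∀ (A W : WeierstrassCurve ℚ) [A.IsElliptic] [A.IsGloballyMinimal] [W.IsElliptic]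
    [W.IsGloballyMinimal] [NeZero (W.conductorNorm ℤ)] [NeZero (A.conductorNorm ℤ)] [NeZero p]
    (χ : DirichletCharacter ℂ p) (D' : ModularParametrizationData A (A.conductorNorm ℤ))
    (D : ModularParametrizationData W (W.conductorNorm ℤ)),
    p.Prime → p ≠ 2 → χ.IsQuadratic → χ.IsPrimitive →
    (∀ z ∈ D.L.lattice, ∃ w ∈ periodLattice D.f, z = D.c * w) →
    Squarefree (A.conductorNorm ℤ) → p ^ 2 ∣ W.conductorNorm ℤ →
    A.conductorNorm ℤ * p ∣ W.conductorNorm ℤ →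
    (∀ n : ℕ, cuspCoeff D.f n = χ n * cuspCoeff D'.f n) →
    ∀ (W₂ : WeierstrassCurve ℚ) [W₂.IsElliptic] [W₂.IsGloballyMinimal]
      (_φ : WeierstrassCurve.Isogeny W W₂) (D₂ : ModularParametrizationData W₂ (W.conductorNorm ℤ)),
      (∀ D₃ : ModularParametrizationData W₂ (W.conductorNorm ℤ), D₂.deg ≤ D₃.deg) →
      ∃ k : ℕ, D₂.c.natAbs = 2 ^ k

end Summit.BirchSwinnertonDyer.Rank1Residual.ManinAdditive

end
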